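import Mathlib
import Literature.MathematicalPhysics.QuantumFieldTheory.MagnenRivasseauSeneor1993.MRS93BackgroundGaugeFixing
import Literature.MathematicalPhysics.QuantumFieldTheory.MagnenRivasseauSeneor1993.MRS93BackgroundLaplacian
import HarnessLib

/-!
# Magnen–Rivasseau–Sénéor (CMP 155, 1993): the CONSTANT-BACKGROUND DICTIONARY between Sect. II's operators as typed in
# momentum space (`covDCoeff` = (II.5) `D = ∂ − λ[A, ·]`, `uOp` = (II.68) `U(A′_s, B′_l)`, `nablaPrime` = (II.50) `∇_{B′_l}·`)
# and Sect. VI's su(2) matrices (VI.6) `P_μ`, (VI.7) `K_FP`, (VI.8) `P²` — kernel-checked: at the zero-mode two-component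
# background of p.369 the former ARE the latter («D_μ = iP_μ», «K_FP = −∂·D = Σ_μ p_μP_μ», «−D² = P²»), hence the normalised
# (VI.4)/(VI.13) `FP` and the `ζ = 1` block `1 + ψU` of (VI.9) for them

statement-level skeleton of published definitions with citation tags; bookkeeping proved; nothing here is a claim about the
Yang–Mills mass gap, about continuum Yang–Mills on `T⁴` without infrared cutoff, or about the Clay problem — and nothing of
Magnen–Rivasseau–Sénéor's analysis is asserted or formalised

**Citation header (reproduction of PUBLISHED work).** J. Magnen, V. Rivasseau, R. Sénéor, *Construction of YM₄ with an infrared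
cutoff*, Commun. Math. Phys. **155** (1993) 325–383 [MagnenRivasseauSeneor1993]: §II.A p.328 tl.28, tl.32–33, (II.5) p.329 tl.11,
p.340 tl.7–8, §VI p.369 [PDF 45] (the sentence introducing the two-component background; (VI.4); (VI.6); (VI.7)), p.370 (VI.8).
Loci `p.NNN tl.nn` = journal page / text-layer line of the held scan `paper:magnen1993-cmp155-mrs-ym4-infrared-cutoff` (PDF page =
journal page − 324); displays read on the decoded page images (renders of record `run/shared/lean/pub/lit-balaban/inprint/
lit-balaban-p14/renders-cmp155/p45_full_s6.png`, `p46_full_s6.png`; seat crops `pub-balaban-gaps-mrs-lit-2/g8/renders/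
p04_crop_r2900-3700_s2.png`, `p04_crop_r3700-4300_s2.png`). Cell pub-balaban-gaps, track G3, seat mrs-lit-2 (gen 8); companion prose
`run/shared/lean/pub/pub-balaban-gaps/g3/MRS-AS-PRINTED-estimates.md` §7 (the cross-seat link this file closes was listed there as
NOT typed; v1 p363296 ✓ commit 960e29e2b004; v1.1 = the proof of `bg_cross` closed by `simp` alone so that no linter is disabled — zero
statement change). Builds BY NAME on seat mrs-lit-1's `…MRS93BackgroundGaugeFixing` (`MainStatement.convCross`, `dCoeff`, `covDCoeff`
(II.5), `uOp`/`uOpB`/`uOp_eq`/`laplaceCoeff_apply` (II.68), `nablaPrime` (II.50), `Parameters.kappaLow`/`kappaSlice`/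
`sliceCoupling`, `box2`) and on this seat's `…MRS93LemmaVI2FeynmanGauge` (`FeynmanGauge.Pmat` (VI.6), `KFP` + `KFP_eq_VI7` (VI.7),
`Psq` + `sum_Pmat_sq_eq_VI8` (VI.8)) and `…MRS93BackgroundLaplacian` (`minusDsq`, `twoComponent`, `minusDsq_twoComponent` (VI.3)).
Nothing is re-declared.

**What the paper prints (verbatim, from the page images).**
* p.328 tl.28: *«With this convention the covariant derivative is D_μ = ∂_μ − λ[A_μ, ·]»*; tl.32–33: *«Remark that in the three
  dimensional su(2) space, the commutator is a wedge product: [A_μ^a, A_ν^b] = ε^c_{ab} A_μ^a A_ν^b.»*; p.329 tl.11, after (II.5):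
  *«where D = ∂ − λ[A, ·] is the covariant derivative.»*; p.328 tl.13–15: *«Moreover the constant fields or the zero mode in Fourier
  space is deleted in all our functional integrals, hence there is no infrared problem.»*
* p.340 tl.7–8: *«for instance in (II.38), λ should be understood as λ_j^t.»*
* p.369 [PDF 45]: *«Similarly the Fadeev-Popov operator (normalized at B = 0) is a three by three matrix in su(2) space:
  FP = 1 + (κ(p)/p²)[−Σ_μ ∂_μD_μ − p²]. (VI.4) Using the Euclidean and global SU(2) symmetry and the fact that B₀ = 0 (because of
  the axial gauge), we can explore completely the function g_{i,α,Δ} by considering a field B with only two non-zero components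
  B₁¹ = x/λ and B₂² = y/λ. Then λ²B² = x² + y² and λ⁴[B, B]² = x²y². The function g_{i,α,Δ} becomes a symmetric function of x
  and y.»*; *«We write ψ = κ_{i,α}(p²)/p². It is convenient to define P_μ such that D_μ = iP_μ (in Fourier space). With these
  conventions we have in su(2) space: P₀ = (p₀ 0 0; 0 p₀ 0; 0 0 p₀), P₃ = (p₃ 0 0; 0 p₃ 0; 0 0 p₃), P₁ = (p₁ 0 0; 0 p₁ −ix;
  0 ix p₁), P₂ = (p₂ 0 iy; 0 p₂ 0; −iy 0 p₂). (VI.6) The Fadeev-Popov operator K_FP = −∂·D = Σ_μ p_μP_μ is K_FP = (p² 0 ip₂y;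
  0 p² −ip₁x; −ip₂y ip₁x p²). (VI.7)»* (3 × 3 matrices written row by row); p.370: *«The hermitian matrix −D² = P² is»* followed by the display (VI.8) (matrix quoted in `…MRS93LemmaVI2FeynmanGauge`).

**What is typed and PROVED here (zero `sorry`, zero named facts; definitions with bodies).**
* §1 `zeroModeBG u v` — the background of p.369 as a momentum-space coefficient function supported at the ZERO MODE `k = 0`:
  direction `1` carries `u·e₁` (colour 1), direction `2` carries `v·e₂` (colour 2), directions `0, 3` vanish (`bgVec`); in print
  `u = B₁¹ = x/λ`, `v = B₂² = y/λ`. `convCross_of_left_zeroMode`: the wedge-product convolution `Σ_{q+r=k} X(q) ×₃ Y(r)` of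
  `…BackgroundGaugeFixing` with a left factor supported at `q = 0` collapses to `X(0) ×₃ Y(k)` (for `0, k` in the summation box).
* §2 **(II.5) ↦ (VI.6)**, `covDCoeff_zeroModeBG`: for every coupling `λ`, ghost-type coefficient function `η`, direction `μ` and
  momentum `k` in the box, `(D_μ(B)η)~(k) = i · P_μ(k; λu, λv) · η̃(k)` with `P_μ` = `FeynmanGauge.Pmat` EXACTLY as printed in (VI.6)
  at `x = λu = λB₁¹`, `y = λv = λB₂²` — the print's «D_μ = iP_μ (in Fourier space)» for the typed (II.5) (`D = ∂ − λ[A,·]`, commutator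
  = wedge product `crossProduct`, `∂_μ ↔ ik_μ` = READING (P) of `…AxialYMAction`). Pure-matrix form: `dCoeff_sub_smul_cross_eq_Pmat`.
* §3 **(VI.8)**, `covDCoeff_covDCoeff_zeroModeBG`: `Σ_μ (D_μ(B)D_μ(B)η)~(k) = −P²(k; λu, λv)·η̃(k)` («−D² = P²», via this seat's
  `sum_Pmat_sq_eq_VI8`); and `…_eq_minusDsq_transpose`: the same equals `−((VI.3) at the two-component background)ᵀ·η̃(k)` (this
  seat's `minusDsq_twoComponent`), with `minusDsq_twoComponent_eq_Psq_neg`: (VI.3) at momentum `p` IS (VI.8) at momentum `−p`.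
* §4 **(II.68) ↦ (VI.7)**, `uOp_zeroModeBG_smallSlot`: with the background in the `A′_s` slot and `B′_l = 0`, `(U(B, 0)η)~(k) =
  −K_FP(k; λu, λv)·η̃(k)` — the print's «K_FP = −∂·D» ((VI.4): `FP ∝ −Σ_μ ∂_μD_μ`; (II.68) at `B′_l = 0` is `∂² − λ∂_μ[A′_{s,μ}, ·] =
  ∂·D(A′_s)`), `K_FP` = `FeynmanGauge.KFP` EXACTLY as printed in (VI.7) (via `KFP_eq_VI7`). Pure-matrix form: `laplace_sub_eq_neg_KFP`.
* §5 **the cut-off slot**, `bgWeight par Nlow ρ₁ k = Σ_{j∈𝐏} λ_j^t κ_j(0) κ^j(k)` (real) and `uOp_zeroModeBG_largeSlot`: with the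
  background in the `B′_l` slot and `A′_s = 0`, `(U(0, B)η)~(k) = −K_FP(k; c·u, c·v)·η̃(k)` with `c = bgWeight … k` — the SAME printed
  matrix with the effective weight `c(k)` in place of `λ` (p.340 tl.7–8 «λ should be understood as λ_j^t»; the cut-off functions
  `κ_j`, `κ^j` of (II.21)/(II.22) enter (II.38)/(II.50)/(II.68) but NOT (VI.6)–(VI.8), which Sect. VI writes for one cell `(i, α)`
  with the slice factor `ψ = κ_{i,α}(p²)/p²` carried separately in (VI.4)/(VI.9)/(VI.13)).
* §6 **(II.50) ↦ Σ_μ iP_μ**, `nablaPrime_zeroModeBG`: `(∇_{B}·A′)~(k) = Σ_μ i · P_μ(k; c·u, c·v) · Ã′_μ(k)` for every fluctuation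
  coefficient function `A′` (the gauge function whose square is the gauge-fixing term (ζ/2)(∇_B·A)² of (II.49)/(VI.2)).
* §7 the sentence p.369 tl.12 *«Then λ²B² = x² + y² and λ⁴[B, B]² = x²y²»* in components: `bg_normSq` (`Σ_{μ,a}(λB_μ^a)² = x² + y²`),
  `bg_cross` (the only non-zero commutators are `[B₁, B₂] = −[B₂, B₁] = uv·e₃`, wedge product), `bg_commSq` (`Σ_{μ,ν,a}(λ²[B_μ,B_ν]^a)²
  = 2x²y²` over ordered pairs = `x²y²` over unordered pairs / with the factor `1/2` of the scalar product of p.328 tl.37–41).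
* §8 the NORMALISED operators of Sect. VI for the typed Sect. II operators, `ψ` a free real parameter (in print `ψ = κ_{i,α}(p²)/p²`):
  `fp_normalised_zeroModeBG` (`η̃ + ψ(−(U(B,0)η)~ − k²η̃) = FP·η̃`, `FP = 1 + ψ(K_FP − p²)` = the printed (VI.13) matrix `FeynmanGauge.FP3`,
  whose determinant `1 − (ψp₁x)² − (ψp₂y)²` is this seat's `det_FP3` — (VI.4)/(VI.13)) and `boson_normalised_zeroModeBG` (`η̃ +
  ψ(−Σ_μ(D_μD_μη)~ − k²η̃) = (1 + ψU)·η̃`, `U = P² − p²` (VI.10), the `ζ = 1` block of (VI.9) = `FeynmanGauge.onePlusPsiU`, whose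
  determinant⁴ is the `ζ = 1` stability polynomial of Lemma VI.2, files 9–10).
* §9 (II.38) itself: at `γ = 0`, `A^{0,2} = A` ((II.6)), `B^{rot 0,2} = B` ((II.32c)), so `∇_B(A_s, B_l, 0, 2) = ∇_{B_l}·A_s`
  (`nablaB_zero_ghost`, from mrs-lit-1's `nablaB_eq_nablaPrime`) and the gauge function of (II.37)/(II.39) at the zero-mode background is
  `Σ_μ i·P_μ(k; c·u, c·v)·Ã_{s,μ}(k)` (`nablaB_zeroModeBG_zero_ghost`).

**What this settles (record §3 finding (k)).** `…MRS93BackgroundLaplacian` proved that the printed (VI.3) at the two-component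
background is the TRANSPOSE (= entrywise conjugate) of the printed (VI.8), leaving open which of the two is `−Σ_μ D_μD_μ` for the
paper's own `D`. Under the paper's stated conventions AS TYPED by seat mrs-lit-1 — (II.5) `D = ∂ − λ[A, ·]`, commutator = wedge
product (p.328 tl.32–33, Mathlib `crossProduct`), and the Fourier reading `∂_μ ↔ +ik_μ` (READING (P)) — §2–§3 give (VI.6) and (VI.8)
on the nose, and (VI.3) is (VI.8) at the opposite momentum (`minusDsq_twoComponent_eq_Psq_neg`), i.e. what the conjugate Fourier
convention `∂_μ ↔ −ik_μ` would print. So (VI.6)–(VI.8) (from which everything downstream — (VI.13)–(VI.17), Lemma VI.2, files 9–21 —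
was computed) are the ones consistent with Sect. II as typed; the clash is a sign convention inside the print of (VI.3), immaterial
for every determinant and trace (transpose invariance, recorded in `…MRS93BackgroundLaplacian`).

**Readings (declared).** (P), (Z), (R″) of `…BackgroundGaugeFixing`/`…AxialYMAction` (unit-volume Parseval, `∂_μ ↔ ik_μ`, products
= convolutions over finite boxes, `λ_j^t` inside `Σ_j`). (CB) CONSTANT BACKGROUND = ZERO MODE: Sect. VI's «field B with only two
non-zero components» (p.369; a constant field — App. 1 p.382 tl.26–27 «in a constant field B») is modelled as the coefficient
function supported at `k = 0`; the paper deletes the zero mode from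
its functional integrals (p.328 tl.13–15) and the windowed configurations `Config`/`Momentum` of `…MainStatementPinned` have none — the
operators of `…BackgroundGaugeFixing` are typed on arbitrary coefficient functions `(Fin 4 → ℤ) → Fin 4 → Fin 3 → ℂ`, which is what
makes the dictionary statable (`covDCoeff T λ X η` is the formula (II.5) `D(X)η = ∂η − λ[X, η]` for ANY coefficient function `X` — in
(II.67) mrs-lit-1 feeds it `X = A′_s`, here it is fed the background `X = B`, which gives Sect. VI's `D` (the covariant derivative in
the background field, (VI.2)–(VI.4)); likewise `uOp`'s two slots); that the large field `B_l` of a cell is well approximated by a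
constant over the cell (the modelling step behind p.369 tl.9–13) is the paper's and is NOT asserted here. (IDX) su(2) colour indices `1, 2, 3` of the print are `Fin 3`'s
`0, 1, 2`; directions `0,…,3` are `Fin 4`'s (as in `FeynmanGauge.Pmat`).

**Honest status / what is NOT claimed.** Algebra between two typed layers of ONE published paper: no estimate, no determinant bound,
nothing about `ψ`, the cut-off functions, or the equality `c(k) = λ`; (VI.2)/(VI.9) (`BF` for general `ζ`) is not re-derived here
(its blocks `P_μP_ν` are the matrices identified in §2–§3), and in §8 `ψ` is a free parameter (the identification `ψ = κ_{i,α}(p²)/p²`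
of p.369 and the slice cut-off are not modelled). Nothing here bears on Bałaban's
papers; nothing is continuum YM₄ on `T⁴`, nothing lifts the infrared cutoff, nothing is Clay.
-/

noncomputable section

open Finset Complex Matrix

namespace Literature.MathematicalPhysics.QuantumFieldTheory.MagnenRivasseauSeneor1993

namespace ConstantBackground

open MainStatement FeynmanGauge Ansatz

/-! ## §1 The zero-mode two-component background and the collapse of the wedge-product convolution -/

/-- The colour vectors of the two-component background of p.369 per direction: `u·e₁` in direction `1`, `v·e₂` in direction `2`,
`0` in directions `0` and `3` (colour indices shifted to `Fin 3`, READING (IDX)); in print `u = B₁¹ = x/λ`, `v = B₂² = y/λ`.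
[cite: MagnenRivasseauSeneor1993, §VI p.369 tl.9–13] -/
def bgVec (u v : ℝ) : Fin 4 → Fin 3 → ℂ
  | 0 => ![0, 0, 0]
  | 1 => ![(u : ℂ), 0, 0]
  | 2 => ![0, (v : ℂ), 0]
  | 3 => ![0, 0, 0]

/-- **The constant background as a momentum-space coefficient function**: supported at the zero mode `k = 0`, with value `bgVec u v`
there (READING (CB)). [cite: MagnenRivasseauSeneor1993, §VI p.369 tl.9–13, §II.A p.328 tl.13–15] -/
def zeroModeBG (u v : ℝ) : (Fin 4 → ℤ) → Fin 4 → Fin 3 → ℂ :=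
  fun q μ => if q = 0 then bgVec u v μ else 0

/-- Value at the zero mode. [cite: MagnenRivasseauSeneor1993, §VI p.369 tl.9–13] -/
@[simp] theorem zeroModeBG_zero (u v : ℝ) (μ : Fin 4) : zeroModeBG u v 0 μ = bgVec u v μ := by
  simp [zeroModeBG]

/-- Vanishing off the zero mode. [cite: MagnenRivasseauSeneor1993, §VI p.369 tl.9–13] -/
@[simp] theorem zeroModeBG_of_ne_zero (u v : ℝ) {q : Fin 4 → ℤ} (hq : q ≠ 0) (μ : Fin 4) : zeroModeBG u v q μ = 0 := by
  simp [zeroModeBG, hq]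

/-- **Collapse of the wedge-product convolution at a zero-mode left factor**: if `X` vanishes off `q = 0` and `0, k` lie in the
summation box `U`, then `Σ_{q,r∈U, q+r=k} X(q) ×₃ Y(r) = X(0) ×₃ Y(k)`. [cite: MagnenRivasseauSeneor1993, §II.A p.328 tl.32–33, (II.38) p.339] -/
theorem convCross_of_left_zeroMode (U : Finset (Fin 4 → ℤ)) (h0 : (0 : Fin 4 → ℤ) ∈ U) {X : (Fin 4 → ℤ) → Fin 3 → ℂ}
    (hX : ∀ q, q ≠ 0 → X q = 0) (Y : (Fin 4 → ℤ) → Fin 3 → ℂ) {k : Fin 4 → ℤ} (hk : k ∈ U) :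
    convCross U X Y k = X 0 ⨯₃ Y k := by
  unfold convCross
  rw [Finset.sum_eq_single_of_mem (0 : Fin 4 → ℤ) h0]
  · simp only [zero_add]
    rw [Finset.sum_ite_eq' U k (fun r => X 0 ⨯₃ Y r), if_pos hk]
  · intro q _ hq
    refine Finset.sum_eq_zero fun r _ => ?_
    rw [hX q hq, LinearMap.map_zero₂]
    split_ifs <;> rfl

/-- The zero mode lies in `box2 T = ({0} ∪ T) + ({0} ∪ T)`. [cite: MagnenRivasseauSeneor1993, (II.38) p.339] -/
theorem zero_mem_box2 (T : Finset (Fin 4 → ℤ)) : (0 : Fin 4 → ℤ) ∈ box2 T := by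
  unfold box2
  exact Finset.mem_image₂.mpr ⟨0, Finset.mem_insert_self 0 T, 0, Finset.mem_insert_self 0 T, add_zero 0⟩

/-- Every momentum of the window lies in `box2 T` (`k = k + 0`). [cite: MagnenRivasseauSeneor1993, (II.38) p.339] -/
theorem mem_box2_of_mem (T : Finset (Fin 4 → ℤ)) {k : Fin 4 → ℤ} (hk : k ∈ insert (0 : Fin 4 → ℤ) T) : k ∈ box2 T := by
  unfold box2
  exact Finset.mem_image₂.mpr ⟨k, hk, 0, Finset.mem_insert_self 0 T, add_zero k⟩

/-- `(∂_μη)~(k)` as a scalar multiple: `dCoeff η μ k = (ik_μ) • η̃(k)`. [cite: MagnenRivasseauSeneor1993, §II.A p.328 tl.12–15, (II.6) p.329] -/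
theorem dCoeff_eq_smul (η : (Fin 4 → ℤ) → Fin 3 → ℂ) (μ : Fin 4) (k : Fin 4 → ℤ) :
    dCoeff η μ k = (I * ((k μ : ℤ) : ℂ)) • η k := by
  funext a
  simp [dCoeff, smul_eq_mul]

/-! ## §2 (II.5) at the constant background is (VI.6): «D_μ = iP_μ (in Fourier space)» -/

/-- **Pure-matrix form of «D_μ = iP_μ»**: for every colour vector `e`, weight `w` and direction `μ`,
`ik_μ·e − w·(bgVec_μ ×₃ e) = i·P_μ(k; wu, wv)·e` with `P_μ` the printed (VI.6) (`FeynmanGauge.Pmat`).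
[cite: MagnenRivasseauSeneor1993, §VI (VI.6) p.369, §II.A p.328 tl.28, tl.32–33] -/
theorem dCoeff_sub_smul_cross_eq_Pmat (w u v : ℝ) (μ : Fin 4) (k : Fin 4 → ℤ) (e : Fin 3 → ℂ) :
    (fun a => I * ((k μ : ℤ) : ℂ) * e a) - (w : ℂ) • (bgVec u v μ ⨯₃ e) =
      I • (Pmat (k 0) (k 1) (k 2) (k 3) (w * u) (w * v) μ).mulVec e := by
  ext a
  fin_cases μ <;> fin_cases a <;>
    simp [bgVec, Pmat, dotProduct, Fin.sum_univ_three, cross_apply] <;> ring_nf <;> simp [Complex.I_sq] <;> ring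

/-- **(II.5) ↦ (VI.6)**: at the zero-mode two-component background, for every coupling `λ`, every ghost-type coefficient function
`η`, every direction `μ` and every momentum `k` of the box, the typed covariant derivative of `…BackgroundGaugeFixing` is
`(D_μ(B)η)~(k) = i·P_μ(k; λu, λv)·η̃(k)` — the printed «D_μ = iP_μ» with (VI.6) at `x = λu = λB₁¹`, `y = λv = λB₂²`.
[cite: MagnenRivasseauSeneor1993, §VI (VI.6) p.369, (II.5) p.329 tl.11, §II.A p.328 tl.28] -/
theorem covDCoeff_zeroModeBG (T : Finset (Fin 4 → ℤ)) (lam u v : ℝ) (η : (Fin 4 → ℤ) → Fin 3 → ℂ) (μ : Fin 4)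
    {k : Fin 4 → ℤ} (hk : k ∈ insert (0 : Fin 4 → ℤ) T) :
    covDCoeff T lam (zeroModeBG u v) η μ k =
      I • (Pmat (k 0) (k 1) (k 2) (k 3) (lam * u) (lam * v) μ).mulVec (η k) := by
  unfold covDCoeff
  rw [convCross_of_left_zeroMode (insert 0 T) (Finset.mem_insert_self 0 T)
    (X := fun q => zeroModeBG u v q μ) (fun q hq => by simp [hq]) η hk]
  simp only [zeroModeBG_zero]
  rw [← dCoeff_sub_smul_cross_eq_Pmat]
  rfl

/-! ## §3 (VI.8) «−D² = P²» for the typed (II.5), and its relation to the printed (VI.3) -/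

/-- **(VI.8) for the typed (II.5)**: `Σ_μ (D_μ(B)(D_μ(B)η))~(k) = −P²(k; λu, λv)·η̃(k)` at the zero-mode background, `P²` the
printed (VI.8) (`FeynmanGauge.Psq`, via `sum_Pmat_sq_eq_VI8`). [cite: MagnenRivasseauSeneor1993, §VI (VI.8) p.370, (VI.6) p.369, (II.5) p.329] -/
theorem covDCoeff_covDCoeff_zeroModeBG (T : Finset (Fin 4 → ℤ)) (lam u v : ℝ) (η : (Fin 4 → ℤ) → Fin 3 → ℂ)
    {k : Fin 4 → ℤ} (hk : k ∈ insert (0 : Fin 4 → ℤ) T) :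
    ∑ μ, covDCoeff T lam (zeroModeBG u v) (fun k' => covDCoeff T lam (zeroModeBG u v) η μ k') μ k =
      -(Psq (k 0) (k 1) (k 2) (k 3) (lam * u) (lam * v)).mulVec (η k) := by
  have h : ∀ μ, covDCoeff T lam (zeroModeBG u v) (fun k' => covDCoeff T lam (zeroModeBG u v) η μ k') μ k =
      -((Pmat (k 0) (k 1) (k 2) (k 3) (lam * u) (lam * v) μ * Pmat (k 0) (k 1) (k 2) (k 3) (lam * u) (lam * v) μ).mulVec
        (η k)) := by
    intro μ
    rw [covDCoeff_zeroModeBG T lam u v _ μ hk]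
    rw [covDCoeff_zeroModeBG T lam u v η μ hk, Matrix.mulVec_smul, smul_smul, Complex.I_mul_I, Matrix.mulVec_mulVec, neg_smul,
      one_smul]
  simp only [h, Finset.sum_neg_distrib, ← Matrix.sum_mulVec, sum_Pmat_sq_eq_VI8]

/-- **(VI.3) is (VI.8) at the opposite momentum**: `minusDsq (twoComponent x y) p = P²(−p; x, y)` — the printed (VI.3) at the
two-component background is what the conjugate Fourier convention `∂_μ ↔ −ik_μ` prints for `−D²` (record §3 finding (k)).
[cite: MagnenRivasseauSeneor1993, §VI (VI.3) p.369, (VI.8) p.370] -/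
theorem minusDsq_twoComponent_eq_Psq_neg (p₀ p₁ p₂ p₃ x y : ℝ) :
    minusDsq (twoComponent x y) ![p₀, p₁, p₂, p₃] = Psq (-p₀) (-p₁) (-p₂) (-p₃) x y := by
  rw [minusDsq_twoComponent]
  ext i j
  fin_cases i <;> fin_cases j <;> simp [Psq, Matrix.transpose_apply]

/-- **… so the typed (II.5) reproduces (VI.8), i.e. the TRANSPOSE of the printed (VI.3)**: `Σ_μ (D_μD_μη)~(k) =
−((VI.3) at the two-component background `x = λu`, `y = λv` and momentum `k`)ᵀ · η̃(k)`.
[cite: MagnenRivasseauSeneor1993, §VI (VI.3) p.369, (VI.8) p.370, (II.5) p.329] -/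
theorem covDCoeff_covDCoeff_eq_minusDsq_transpose (T : Finset (Fin 4 → ℤ)) (lam u v : ℝ) (η : (Fin 4 → ℤ) → Fin 3 → ℂ)
    {k : Fin 4 → ℤ} (hk : k ∈ insert (0 : Fin 4 → ℤ) T) :
    ∑ μ, covDCoeff T lam (zeroModeBG u v) (fun k' => covDCoeff T lam (zeroModeBG u v) η μ k') μ k =
      -(minusDsq (twoComponent (lam * u) (lam * v)) ![((k 0 : ℤ) : ℝ), ((k 1 : ℤ) : ℝ), ((k 2 : ℤ) : ℝ), ((k 3 : ℤ) : ℝ)])ᵀ.mulVec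
        (η k) := by
  rw [covDCoeff_covDCoeff_zeroModeBG T lam u v η hk, minusDsq_twoComponent, Matrix.transpose_transpose]

/-! ## §4 (II.68) at the constant background in the `A′_s` slot is (VI.7): «K_FP = −∂·D = Σ_μ p_μP_μ» -/

/-- **Pure-matrix form of «K_FP = −∂·D»**: `−|k|²·e − w·Σ_μ ik_μ·(bgVec_μ ×₃ e) = −K_FP(k; wu, wv)·e` with `K_FP` the printed
(VI.7) (`FeynmanGauge.KFP`). [cite: MagnenRivasseauSeneor1993, §VI (VI.7) p.369, (II.68) p.344] -/
theorem laplace_sub_eq_neg_KFP (w u v : ℝ) (k : Fin 4 → ℤ) (e : Fin 3 → ℂ) :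
    (fun a => -(∑ μ, ((k μ : ℤ) : ℂ) ^ 2) * e a) - (w : ℂ) • ∑ μ : Fin 4, (fun a => I * ((k μ : ℤ) : ℂ) * (bgVec u v μ ⨯₃ e) a) =
      -(KFP (k 0) (k 1) (k 2) (k 3) (w * u) (w * v)).mulVec e := by
  ext a
  simp only [Fin.sum_univ_four, Pi.sub_apply, Pi.smul_apply, Pi.add_apply, Pi.neg_apply, smul_eq_mul]
  fin_cases a <;>
    simp [bgVec, KFP, Matrix.mulVec, dotProduct, Fin.sum_univ_three, cross_apply] <;> ring

/-- (II.68) with `B′_l = 0`: the cut-off `B′_l`-term drops and `U(A′_s, 0)η = ∂²η − λ∂_μ[A′_{s,μ}, η]` (= `∂·D(A′_s)η`).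
[cite: MagnenRivasseauSeneor1993, (II.68) p.344 tl.19, (II.5) p.329] -/
theorem uOp_largeSlot_zero (par : Parameters) (Nlow : ℕ → ℕ) (T : Finset (Fin 4 → ℤ)) (ρ₁ : ℕ) (lam : ℝ)
    (A' : (Fin 4 → ℤ) → Fin 4 → Fin 3 → ℂ) (η : (Fin 4 → ℤ) → Fin 3 → ℂ) (k : Fin 4 → ℤ) :
    uOp par Nlow T ρ₁ lam A' 0 η k =
      laplaceCoeff η k - (lam : ℂ) • ∑ μ, dCoeff (fun k' => convCross (insert 0 T) (fun q => A' q μ) η k') μ k := by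
  rw [uOp_eq]
  have hB : ∀ j μ, uOpB par Nlow T ρ₁ 0 η j μ k = 0 := by
    intro j μ
    unfold uOpB
    have h : (fun q => ((par.kappaLow Nlow ρ₁ j q : ℝ) : ℂ) • fun a => (0 : (Fin 4 → ℤ) → Fin 4 → Fin 3 → ℂ) q μ a) =
        fun _ => 0 := by
      funext q
      ext a
      simp
    rw [h]
    exact convCross_zero_left _ _ _
  simp [hB]

/-- **(II.68) ↦ (VI.7), background in the `A′_s` slot**: at `A′_s` = the zero-mode two-component background and `B′_l = 0`, for
every coupling `λ`, ghost-type `η` and momentum `k` of the box, `(U(B, 0)η)~(k) = −K_FP(k; λu, λv)·η̃(k)` — the printed «K_FP = −∂·D»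
with (VI.7) at `x = λB₁¹`, `y = λB₂²`. [cite: MagnenRivasseauSeneor1993, §VI (VI.7), (VI.4) p.369, (II.68) p.344 tl.19] -/
theorem uOp_zeroModeBG_smallSlot (par : Parameters) (Nlow : ℕ → ℕ) (T : Finset (Fin 4 → ℤ)) (ρ₁ : ℕ) (lam u v : ℝ)
    (η : (Fin 4 → ℤ) → Fin 3 → ℂ) {k : Fin 4 → ℤ} (hk : k ∈ insert (0 : Fin 4 → ℤ) T) :
    uOp par Nlow T ρ₁ lam (zeroModeBG u v) 0 η k = -(KFP (k 0) (k 1) (k 2) (k 3) (lam * u) (lam * v)).mulVec (η k) := by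
  rw [uOp_largeSlot_zero]
  have hμ : ∀ μ, dCoeff (fun k' => convCross (insert 0 T) (fun q => zeroModeBG u v q μ) η k') μ k =
      fun a => I * ((k μ : ℤ) : ℂ) * (bgVec u v μ ⨯₃ η k) a := by
    intro μ
    unfold dCoeff
    beta_reduce
    rw [convCross_of_left_zeroMode (insert 0 T) (Finset.mem_insert_self 0 T)
      (X := fun q => zeroModeBG u v q μ) (fun q hq => by simp [hq]) η hk]
    simp only [zeroModeBG_zero]
  have hL : laplaceCoeff η k = fun a => -(∑ μ, ((k μ : ℤ) : ℂ) ^ 2) * η k a := by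
    funext a
    exact laplaceCoeff_apply η k a
  simp only [hμ, hL]
  exact laplace_sub_eq_neg_KFP lam u v k (η k)

/-! ## §5 The cut-off slot: (II.68) with the background in the `B′_l` slot carries the weight `Σ_j λ_j^t κ_j(0) κ^j(k)` -/

/-- **The effective background weight of the cut-off slot** at fluctuation momentum `k`: `c(k) = Σ_{j∈𝐏} λ_j^t κ_j(0) κ^j(k)` —
the coupling `λ_j^t` (p.340 tl.7–8 «λ should be understood as λ_j^t») times the background cutoff (II.22) at the zero mode times the
slice function (II.21) at `k`, summed over the index set 𝐏 (all three the tree's objects of `…BackgroundGaugeFixing`).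
[cite: MagnenRivasseauSeneor1993, (II.38) p.339 tl.37, p.340 tl.2–8, (II.21)–(II.22) p.335] -/
def bgWeight (par : Parameters) (Nlow : ℕ → ℕ) (ρ₁ : ℕ) (k : Fin 4 → ℤ) : ℝ :=
  ∑ j ∈ indexFinset Nlow ρ₁, par.sliceCoupling j * (par.kappaLow Nlow ρ₁ j 0 * par.kappaSlice Nlow j k)

/-- The cut-off `B′_l`-sum of (II.50)/(II.68) at the zero-mode background collapses, for every `μ`-family of right factors `Y μ`,
to `c(k) • Σ_μ bgVec_μ ×₃ Y_μ(k)`. [cite: MagnenRivasseauSeneor1993, (II.38) p.339, (II.50) p.342, (II.68) p.344, p.340 tl.2–8] -/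
theorem largeSlot_sum_zeroModeBG (par : Parameters) (Nlow : ℕ → ℕ) (T : Finset (Fin 4 → ℤ)) (ρ₁ : ℕ) (u v : ℝ)
    (Y : Fin 4 → (Fin 4 → ℤ) → Fin 3 → ℂ) {k : Fin 4 → ℤ} (hk : k ∈ box2 T) :
    ∑ j ∈ indexFinset Nlow ρ₁, ((par.sliceCoupling j : ℝ) : ℂ) • ∑ μ : Fin 4,
        convCross (box2 T) (fun q => ((par.kappaLow Nlow ρ₁ j q : ℝ) : ℂ) • fun a => zeroModeBG u v q μ a)
          (fun r => ((par.kappaSlice Nlow j r : ℝ) : ℂ) • Y μ r) k =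
      ((bgWeight par Nlow ρ₁ k : ℝ) : ℂ) • ∑ μ : Fin 4, (bgVec u v μ ⨯₃ Y μ k) := by
  have hconv : ∀ j μ, convCross (box2 T) (fun q => ((par.kappaLow Nlow ρ₁ j q : ℝ) : ℂ) • fun a => zeroModeBG u v q μ a)
      (fun r => ((par.kappaSlice Nlow j r : ℝ) : ℂ) • Y μ r) k =
        (((par.kappaLow Nlow ρ₁ j 0 : ℝ) : ℂ) * ((par.kappaSlice Nlow j k : ℝ) : ℂ)) • (bgVec u v μ ⨯₃ Y μ k) := by
    intro j μ
    rw [convCross_of_left_zeroMode (box2 T) (zero_mem_box2 T) (fun q hq => by ext a; simp [hq]) _ hk]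
    simp only [zeroModeBG_zero]
    rw [LinearMap.map_smul₂, LinearMap.map_smul, smul_smul]
  simp only [hconv, ← Finset.smul_sum, smul_smul, bgWeight]
  push_cast
  rw [Finset.sum_smul]

/-- (II.68) with `A′_s = 0`: the `λ∂_μ[A′_{s,μ}, ·]` term drops. [cite: MagnenRivasseauSeneor1993, (II.68) p.344 tl.19] -/
theorem uOp_smallSlot_zero (par : Parameters) (Nlow : ℕ → ℕ) (T : Finset (Fin 4 → ℤ)) (ρ₁ : ℕ) (lam : ℝ)
    (B' : (Fin 4 → ℤ) → Fin 4 → Fin 3 → ℂ) (η : (Fin 4 → ℤ) → Fin 3 → ℂ) (k : Fin 4 → ℤ) :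
    uOp par Nlow T ρ₁ lam 0 B' η k =
      laplaceCoeff η k - ∑ j ∈ indexFinset Nlow ρ₁, ((par.sliceCoupling j : ℝ) : ℂ) • ∑ μ, uOpB par Nlow T ρ₁ B' η j μ k := by
  rw [uOp_eq]
  have hA : ∀ μ, dCoeff (fun k' => convCross (insert 0 T) (fun _ => (0 : Fin 3 → ℂ)) η k') μ k = 0 := by
    intro μ
    funext a
    simp [dCoeff, convCross_zero_left]
  simp [hA]

/-- **(II.68) ↦ (VI.7), background in the cut-off `B′_l` slot**: at `B′_l` = the zero-mode two-component background and `A′_s = 0`,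
for every `λ`, ghost-type `η` and momentum `k ∈ box2 T`, `(U(0, B)η)~(k) = −K_FP(k; c·u, c·v)·η̃(k)` with `c = bgWeight … k` — the
printed matrix (VI.7) with the effective weight `c(k) = Σ_j λ_j^t κ_j(0) κ^j(k)` in place of `λ` (no claim that `c = λ`).
[cite: MagnenRivasseauSeneor1993, §VI (VI.7) p.369, (II.68) p.344 tl.19, p.340 tl.7–8] -/
theorem uOp_zeroModeBG_largeSlot (par : Parameters) (Nlow : ℕ → ℕ) (T : Finset (Fin 4 → ℤ)) (ρ₁ : ℕ) (lam u v : ℝ)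
    (η : (Fin 4 → ℤ) → Fin 3 → ℂ) {k : Fin 4 → ℤ} (hk : k ∈ box2 T) :
    uOp par Nlow T ρ₁ lam 0 (zeroModeBG u v) η k =
      -(KFP (k 0) (k 1) (k 2) (k 3) (bgWeight par Nlow ρ₁ k * u) (bgWeight par Nlow ρ₁ k * v)).mulVec (η k) := by
  rw [uOp_smallSlot_zero]
  have h3 : ∑ j ∈ indexFinset Nlow ρ₁, ((par.sliceCoupling j : ℝ) : ℂ) • ∑ μ, uOpB par Nlow T ρ₁ (zeroModeBG u v) η j μ k =
      ((bgWeight par Nlow ρ₁ k : ℝ) : ℂ) • ∑ μ : Fin 4, (bgVec u v μ ⨯₃ dCoeff η μ k) := by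
    unfold uOpB
    exact largeSlot_sum_zeroModeBG par Nlow T ρ₁ u v (fun μ r => dCoeff η μ r) hk
  rw [h3]
  have hμ : ∀ μ, bgVec u v μ ⨯₃ dCoeff η μ k = fun a => I * ((k μ : ℤ) : ℂ) * (bgVec u v μ ⨯₃ η k) a := by
    intro μ
    rw [dCoeff_eq_smul, LinearMap.map_smul]
    funext a
    simp [smul_eq_mul, mul_assoc]
  have hL : laplaceCoeff η k = fun a => -(∑ μ, ((k μ : ℤ) : ℂ) ^ 2) * η k a := by
    funext a
    exact laplaceCoeff_apply η k a
  simp only [hμ, hL]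
  exact laplace_sub_eq_neg_KFP (bgWeight par Nlow ρ₁ k) u v k (η k)

/-! ## §6 (II.50) at the constant background: `∇_B·A′ = Σ_μ iP_μ Ã′_μ` -/

/-- **(II.50) ↦ Σ_μ iP_μ**: at `B′_l` = the zero-mode two-component background, for every fluctuation coefficient function `A′`
and every momentum `k ∈ box2 T`, `(∇_{B}·A′)~(k) = Σ_μ i·P_μ(k; c·u, c·v)·Ã′_μ(k)` with (VI.6)'s `P_μ` at the effective weight
`c = bgWeight … k`. [cite: MagnenRivasseauSeneor1993, (II.50) p.342 tl.29, §VI (VI.6) p.369, p.340 tl.7–8] -/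
theorem nablaPrime_zeroModeBG (par : Parameters) (Nlow : ℕ → ℕ) (T : Finset (Fin 4 → ℤ)) (ρ₁ : ℕ) (u v : ℝ)
    (A' : (Fin 4 → ℤ) → Fin 4 → Fin 3 → ℂ) {k : Fin 4 → ℤ} (hk : k ∈ box2 T) :
    nablaPrime par Nlow T ρ₁ A' (zeroModeBG u v) k =
      ∑ μ, I • (Pmat (k 0) (k 1) (k 2) (k 3) (bgWeight par Nlow ρ₁ k * u) (bgWeight par Nlow ρ₁ k * v) μ).mulVec (A' k μ) := by
  unfold nablaPrime
  rw [Finset.sum_sub_distrib]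
  have h3 : ∑ μ : Fin 4, ∑ j ∈ indexFinset Nlow ρ₁, ((par.sliceCoupling j : ℝ) : ℂ) •
      convCross (box2 T) (fun q => ((par.kappaLow Nlow ρ₁ j q : ℝ) : ℂ) • fun a => zeroModeBG u v q μ a)
        (fun r => ((par.kappaSlice Nlow j r : ℝ) : ℂ) • fun a => A' r μ a) k =
      ∑ μ : Fin 4, ((bgWeight par Nlow ρ₁ k : ℝ) : ℂ) • (bgVec u v μ ⨯₃ A' k μ) := by
    rw [Finset.sum_comm, ← Finset.smul_sum]
    have h := largeSlot_sum_zeroModeBG par Nlow T ρ₁ u v (fun μ r => fun a => A' r μ a) hk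
    simp only [Finset.smul_sum] at h ⊢
    simpa using h
  rw [h3, ← Finset.sum_sub_distrib]
  refine Finset.sum_congr rfl fun μ _ => ?_
  rw [← dCoeff_sub_smul_cross_eq_Pmat]
  rfl

/-! ## §7 The two printed invariants of the background: «λ²B² = x² + y² and λ⁴[B, B]² = x²y²» (p.369 tl.12) -/

/-- **p.369 tl.12, first invariant, in components**: `Σ_μ Σ_a (λB_μ^a)² = x² + y²` for the two-component background (`x = λu`,
`y = λv`; plain sum over the components — with the factor `1/2` of the scalar product of p.328 tl.37–41 the same sum reads `(x² + y²)/2`,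
the print's «B²» here is the component sum). [cite: MagnenRivasseauSeneor1993, §VI p.369 tl.12] -/
theorem bg_normSq (lam u v : ℝ) :
    ∑ μ : Fin 4, ∑ a : Fin 3, ((lam : ℂ) * bgVec u v μ a) ^ 2 = (((lam * u) ^ 2 + (lam * v) ^ 2 : ℝ) : ℂ) := by
  simp [Fin.sum_univ_four, Fin.sum_univ_three, bgVec]

/-- The only non-vanishing commutators of the background: `[B₁, B₂] = −[B₂, B₁] = uv·e₃` (wedge product, p.328 tl.32–33); all other
`[B_μ, B_ν]` vanish. [cite: MagnenRivasseauSeneor1993, §VI p.369 tl.12, §II.A p.328 tl.32–33] -/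
theorem bg_cross (u v : ℝ) (μ ν : Fin 4) (a : Fin 3) :
    (bgVec u v μ ⨯₃ bgVec u v ν) a =
      if μ = 1 ∧ ν = 2 ∧ a = 2 then (u : ℂ) * v else if μ = 2 ∧ ν = 1 ∧ a = 2 then -((u : ℂ) * v) else 0 := by
  fin_cases μ <;> fin_cases ν <;> fin_cases a <;> simp [bgVec, cross_apply, mul_comm]

/-- **p.369 tl.12, second invariant, in components**: `Σ_{μ,ν} Σ_a (λ²[B_μ, B_ν]^a)² = 2x²y²` over ORDERED pairs, i.e. `x²y²` over
unordered pairs `μ < ν` / with the factor `1/2` of p.328's scalar product — the print's «λ⁴[B, B]² = x²y²».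
[cite: MagnenRivasseauSeneor1993, §VI p.369 tl.12, §II.A p.328 tl.37–41] -/
theorem bg_commSq (lam u v : ℝ) :
    ∑ μ : Fin 4, ∑ ν : Fin 4, ∑ a : Fin 3, ((lam : ℂ) ^ 2 * (bgVec u v μ ⨯₃ bgVec u v ν) a) ^ 2 =
      ((2 * ((lam * u) * (lam * v)) ^ 2 : ℝ) : ℂ) := by
  simp only [bg_cross]
  simp [Fin.sum_univ_four, Fin.sum_univ_three]
  ring

/-! ## §8 The normalised operators of Sect. VI for the typed Sect. II operators: (VI.4)/(VI.13) `FP = 1 + ψ(K_FP − p²)` and the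
`ζ = 1` block `1 + ψU = 1 + ψ(P² − p²)` of (VI.9)/(VI.10) -/

/-- **(VI.4)/(VI.13) for the typed (II.68)**: `η̃(k) + ψ·(−(U(B,0)η)~(k) − k²·η̃(k)) = FP·η̃(k)` with `FP = 1 + ψ(K_FP − p²)` the printed
(VI.13) matrix (`FeynmanGauge.FP3` at `m₁ = ψk₁x`, `m₂ = ψk₂y`, via `FP3_eq`) — (VI.4) «FP = 1 + (κ(p)/p²)[−Σ_μ ∂_μD_μ − p²]» with
`ψ` a free real parameter here (in print `ψ = κ_{i,α}(p²)/p²`, not modelled). [cite: MagnenRivasseauSeneor1993, §VI (VI.4) p.369, (VI.13) p.372, (II.68) p.344] -/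
theorem fp_normalised_zeroModeBG (par : Parameters) (Nlow : ℕ → ℕ) (T : Finset (Fin 4 → ℤ)) (ρ₁ : ℕ) (ψ lam u v : ℝ)
    (η : (Fin 4 → ℤ) → Fin 3 → ℂ) {k : Fin 4 → ℤ} (hk : k ∈ insert (0 : Fin 4 → ℤ) T) :
    η k + (ψ : ℂ) • (-(uOp par Nlow T ρ₁ lam (zeroModeBG u v) 0 η k) - (∑ μ, ((k μ : ℤ) : ℂ) ^ 2) • η k) =
      (FP3 (ψ * k 1 * (lam * u)) (ψ * k 2 * (lam * v))).mulVec (η k) := by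
  rw [uOp_zeroModeBG_smallSlot par Nlow T ρ₁ lam u v η hk, FP3_eq ψ (k 0) (k 1) (k 2) (k 3) (lam * u) (lam * v), neg_neg,
    Matrix.add_mulVec, Matrix.one_mulVec, Matrix.smul_mulVec, Matrix.sub_mulVec, Matrix.smul_mulVec, Matrix.one_mulVec]
  simp [Fin.sum_univ_four]

/-- **The `ζ = 1` boson block of (VI.9) for the typed (II.5)**: `η̃(k) + ψ·(−Σ_μ(D_μD_μη)~(k) − k²·η̃(k)) = (1 + ψU)·η̃(k)` with
`1 + ψU = 1 + ψ(P² − p²)` ((VI.9) first term, `U = P² − p²` (VI.10); `FeynmanGauge.onePlusPsiU` via `onePlusPsiU_eq`), `ψ` free.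
[cite: MagnenRivasseauSeneor1993, §VI (VI.9)–(VI.10) p.370, (VI.8) p.370, (II.5) p.329] -/
theorem boson_normalised_zeroModeBG (T : Finset (Fin 4 → ℤ)) (ψ lam u v : ℝ) (η : (Fin 4 → ℤ) → Fin 3 → ℂ)
    {k : Fin 4 → ℤ} (hk : k ∈ insert (0 : Fin 4 → ℤ) T) :
    η k + (ψ : ℂ) • (-(∑ μ, covDCoeff T lam (zeroModeBG u v) (fun k' => covDCoeff T lam (zeroModeBG u v) η μ k') μ k) -
        (∑ μ, ((k μ : ℤ) : ℂ) ^ 2) • η k) =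
      (onePlusPsiU (ψ * (lam * u) ^ 2) (ψ * (lam * v) ^ 2) (ψ * k 1 * (lam * u)) (ψ * k 2 * (lam * v))).mulVec (η k) := by
  rw [covDCoeff_covDCoeff_zeroModeBG T lam u v η hk, onePlusPsiU_eq ψ (k 0) (k 1) (k 2) (k 3) (lam * u) (lam * v), neg_neg,
    Matrix.add_mulVec, Matrix.one_mulVec, Matrix.smul_mulVec, Matrix.sub_mulVec, Matrix.smul_mulVec, Matrix.one_mulVec]
  simp [Fin.sum_univ_four]

/-! ## §9 (II.38) itself at `γ = 0`: `∇_B(A_s, B_l, 0, 2) = ∇_{B_l}·A_s`, hence the dictionary for the gauge function of (II.37)/(II.39) -/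

/-- `(∂_μ 0)~ = 0`. [cite: MagnenRivasseauSeneor1993, (II.6) p.329] -/
theorem dCoeff_zero (μ : Fin 4) (k : Fin 4 → ℤ) : dCoeff (fun _ => (0 : Fin 3 → ℂ)) μ k = 0 := by
  funext a
  simp [dCoeff]

/-- A wedge-product convolution with a vanishing right factor vanishes. [cite: MagnenRivasseauSeneor1993, §II.A p.328 tl.32–33] -/
theorem convCross_zero_right (U : Finset (Fin 4 → ℤ)) (X : (Fin 4 → ℤ) → Fin 3 → ℂ) (k : Fin 4 → ℤ) :
    convCross U X (fun _ => 0) k = 0 := by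
  unfold convCross
  refine Finset.sum_eq_zero fun q _ => Finset.sum_eq_zero fun r _ => ?_
  rw [map_zero]
  split_ifs <;> rfl

/-- (II.6) at `γ = 0`: `A^{0,2} = A`. [cite: MagnenRivasseauSeneor1993, (II.6) p.329 tl.16] -/
theorem gaugeTrunc2Coeff_zero_ghost (T : Finset (Fin 4 → ℤ)) (lam : ℝ) (A : (Fin 4 → ℤ) → Fin 4 → Fin 3 → ℂ) (μ : Fin 4)
    (k : Fin 4 → ℤ) : gaugeTrunc2Coeff T lam A 0 μ k = A k μ := by
  unfold gaugeTrunc2Coeff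
  have h0 : (0 : (Fin 4 → ℤ) → Fin 3 → ℂ) = fun _ => 0 := rfl
  rw [h0, convCross_zero_right, convCross_zero_left, dCoeff_zero, smul_zero, smul_zero, add_zero, sub_zero, add_zero]

/-- (II.32c) at `γ = 0`: `B^{rot 0,2} = B`. [cite: MagnenRivasseauSeneor1993, (II.32c) p.339 tl.2–3] -/
theorem rotTruncCoeff_zero_ghost (T : Finset (Fin 4 → ℤ)) (lam : ℝ) (B : (Fin 4 → ℤ) → Fin 4 → Fin 3 → ℂ) (μ : Fin 4)
    (k : Fin 4 → ℤ) : rotTruncCoeff T lam B 0 μ k = B k μ := by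
  unfold rotTruncCoeff
  have h0 : (0 : (Fin 4 → ℤ) → Fin 3 → ℂ) = fun _ => 0 := rfl
  rw [h0, convCross_zero_right, smul_zero, sub_zero]

/-- **(II.38) at `γ = 0` is (II.50)**: `∇_B(A_s, B_l, 0, 2) = ∇_{B_l}·A_s` (mrs-lit-1's `nablaB_eq_nablaPrime` with (II.6)/(II.32c) at
`γ = 0`). [cite: MagnenRivasseauSeneor1993, (II.38) p.339 tl.37, (II.50) p.342 tl.29, (II.48) p.342] -/
theorem nablaB_zero_ghost (par : Parameters) (Nlow : ℕ → ℕ) (T : Finset (Fin 4 → ℤ)) (ρ₁ : ℕ) (lam : ℝ)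
    (A B : (Fin 4 → ℤ) → Fin 4 → Fin 3 → ℂ) (k : Fin 4 → ℤ) :
    nablaB par Nlow T ρ₁ lam A B 0 k = nablaPrime par Nlow T ρ₁ A B k := by
  rw [nablaB_eq_nablaPrime]
  simp only [gaugeTrunc2Coeff_zero_ghost, rotTruncCoeff_zero_ghost]

/-- **(II.38) ↦ Σ_μ iP_μ**: the gauge function of (II.37)/(II.39) at `γ = 0` and `B_l` = the zero-mode two-component background is
`(∇_B(A_s, B_l, 0, 2))~(k) = Σ_μ i·P_μ(k; c·u, c·v)·Ã_{s,μ}(k)`, `c = bgWeight … k`, for every small-field coefficient function `A_s` and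
every `k ∈ box2 T`. [cite: MagnenRivasseauSeneor1993, (II.37)–(II.38) p.339, §VI (VI.6) p.369, p.340 tl.7–8] -/
theorem nablaB_zeroModeBG_zero_ghost (par : Parameters) (Nlow : ℕ → ℕ) (T : Finset (Fin 4 → ℤ)) (ρ₁ : ℕ) (lam u v : ℝ)
    (A : (Fin 4 → ℤ) → Fin 4 → Fin 3 → ℂ) {k : Fin 4 → ℤ} (hk : k ∈ box2 T) :
    nablaB par Nlow T ρ₁ lam A (zeroModeBG u v) 0 k =
      ∑ μ, I • (Pmat (k 0) (k 1) (k 2) (k 3) (bgWeight par Nlow ρ₁ k * u) (bgWeight par Nlow ρ₁ k * v) μ).mulVec (A k μ) := by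
  rw [nablaB_zero_ghost]
  exact nablaPrime_zeroModeBG par Nlow T ρ₁ u v A hk

end ConstantBackground

end Literature.MathematicalPhysics.QuantumFieldTheory.MagnenRivasseauSeneor1993
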